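import Mathlib
import Literature.NumberTheory.EllipticCurves.GaloisActionProofs
import HarnessLib

/-!
# Cremona–Freitas, *Global methods for the symplectic type of congruences between elliptic
# curves* (Rev. Mat. Iberoam. 38 (2022), no. 1, 1–32 = arXiv:1910.12290v2), §3.5, Theorem 3.6:
# the criterion for `E₁[p] ≅ E₂[p]` when `E[p]` is REDUCIBLE — PROVED

HONEST FRAMING (cell `b2b-bsdres`, home `run/shared/lean/b2b/bsd-rank1-residual/`): the cell deletes
COMBINATION-SHAPED residual classes of the rank-`≤ 1` BSD formula from PUBLISHED theorems only and
types the rest; this is not "finishing BSD". This file vendors ONE published theorem together with OUR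
FORMALISATION OF ITS PROOF (no named fact, no `sorry`, net named-fact debt 0). Its role in the cell: it
is the REDUCIBLE twin of `KrausOesterle1992.prop4_torsionIso_of_congruences`
(`KrausOesterle1992/TorsionCongruenceCriterion.lean`, the irreducible case): it turns the certificate
binder "a `Γ_ℚ`-equivariant isomorphism `E₁[p] ≃ E₂[p]`" (`TorsionIso` of
`Summits/BirchSwinnertonDyer/Rank1Residual/X1/CongruenceTransfer.lean`, the hypothesis of
Greenberg–Vatsal's Thm. (1.4) and of every congruence-transfer theorem of the cell) into FINITE, EXACT
data when `E₁[p]`, `E₂[p]` are reducible: equal isogeny characters and isomorphic "second-isogeny"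
fields of degree `p` (the shape certified by the cell's instrument `TISO-RED`, `class-closure/eng-2/
TISO-1.md`: Conrey label of `χ₁` + `nfisisom` of the degree-`p` stem fields). Unlike the irreducible
criterion (Sturm bound, modularity) this one is pure group theory, so it is PROVED here outright.

SOURCE (read 2026-08-21 on the typeset arXiv v2 PDF, pp. 23–24, numbering checked against the PDF:
"Proposition 3.4", "Proposition 3.5", "Theorem 3.6" in "3.5. Auxiliary results for the reducible
case"; the journal version doi:10.4171/rmi/1269 has the same section structure). Verbatim:

* "**Proposition 3.4.** Let `H = D · U ⊂ B` and `π` be as above [`B ⊂ GL₂(𝔽_p)` the Borel subgroup,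
  `H ⊂ B` a subgroup of order divisible by `p`, `H = D · U`, `D` diagonal, `U = ⟨(1 1; 0 1)⟩`,
  `π : H → H/U ≃ D`]. Let `φ` be an automorphism of `H`. Assume that `π(x) = π(φ(x))` for all `x ∈ H`.
  Then `φ` is given by conjugation in `B`, i.e. there is `A ∈ B` such that `φ(x) = A x A⁻¹`."
* "**Proposition 3.5.** Let `p` be a prime. Let `E/K` be an elliptic curve such that `ρ̄_{E,p}` is
  reducible. Assume there is an element of order `p` in the image of `ρ̄_{E,p}`. Then, there is an
  extension `F/K` of degree `p`, unique up to Galois conjugacy, such that `E` acquires a second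
  isogeny over `F`." (Proof, p. 23: in a basis with `ρ̄_{E,p} = (χ h; 0 χ')`, `F` is the fixed field
  of `H = {σ : h(σ) = 0}`, i.e. OF THE STABILISER OF A NON-INVARIANT LINE of `E[p]`; the other
  non-invariant lines give the conjugate subgroups `gⁱ H g⁻ⁱ`.)
* "**Theorem 3.6.** Let `p` be a prime. Let `E₁, E₂` be elliptic curves over `K` such that
  (i) `ρ̄^{ss}_{E₁,p} ≃ ρ̄^{ss}_{E₂,p} ≃ χ ⊕ χ'`, where `χ, χ' : G_K → 𝔽_p^*` are characters;
  (ii) both `ρ̄_{E₁,p}` and `ρ̄_{E₂,p}` have an element of order `p` in their image.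
  For `i = 1, 2`, let `F_i/K` be a degree `p` extension where `E_i` acquires a second isogeny, as
  given by Proposition 3.5. After replacing `E₂` by a `p`-isogenous curve if necessary, we have
  `ρ̄_{E₁,p} ≃ ρ̄_{E₂,p}` if and only if `F₁ ≃ F₂` (as extensions of `K`)."
  (Proof, p. 24: "after replacing `E₂` by a `p`-isogenous curve if necessary (to swap `χ` with `χ'`),
  we have, for `i = 1, 2`, `ρ̄_{E_i,p} = (χ h_i; 0 χ')` with `h_i : G_K → 𝔽_p`".)

## What is formalised, and how it is transcribed

The theorem vendored is the "if" direction of Theorem 3.6 (the direction a CERTIFICATE consumes: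
finite data ⇒ `E₁[p] ≅ E₂[p]`), in two layers.

1. `addEquiv_of_reducible_of_lineStabilizer_iff` — Theorem 3.6 (⇐) for two abstract
   `𝔽_p[G]`-modules `V₁, V₂` of order `p²` (`G` any group). TRANSCRIPTION of the hypotheses:
   (i) *after the swap normalisation of the proof* — `T_i ∈ V_i` spans a `G`-stable line on which `G`
   acts through the SAME character (`σ • T₁ = c • T₁ ∧ σ • T₂ = c • T₂`, one integer `c = χ(σ)` for
   both), and `G` acts on the quotients `V_i / 𝔽_p T_i` through the SAME character `χ'` (read on
   chosen vectors `P_i ∉ 𝔽_p T_i`: `σ • P_i - c' • P_i ∈ 𝔽_p T_i`, one integer `c' = χ'(σ)` for both);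
   (ii) "an element of order `p` in the image": `∃ σ₀, ρ(σ₀)^p = ρ(σ₀^p) = 1 ∧ ρ(σ₀) ≠ 1`, i.e.
   `(∀ x, σ₀^p • x = x) ∧ (∃ x, σ₀ • x ≠ x)` (for `p` prime this IS `orderOf ρ(σ₀) = p`, Mathlib's
   `orderOf_eq_prime_iff`; the repackaging for the tree's `galoisRepTorsion` is
   `smul_pow_eq_and_exists_ne_of_orderOf_eq`); it is assumed for `V₁` only — for `V₂` it then
   FOLLOWS from the other hypotheses (the proof below shows `h₂(σ₀) ≠ 0`), so the printed "both" is
   kept in the elliptic-curve statement only as a remark;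
   "`F₁ ≃ F₂` as extensions of `K`": `F_i` is the fixed field of the stabiliser `Stab_G(𝔽_p P_i)` of
   a non-invariant line (Prop. 3.5, proof), two subextensions of `K̄/K` are `K`-isomorphic iff their
   groups are CONJUGATE in `G_K`, and a conjugate `τ Stab(𝔽_p P) τ⁻¹ = Stab(𝔽_p (τ • P))` is again the
   stabiliser of a non-invariant line; so "`F₁ ≃ F₂`" says exactly: FOR SOME CHOICE of the
   non-invariant lines `𝔽_p P₁ ⊂ V₁`, `𝔽_p P₂ ⊂ V₂` the stabilisers coincide,
   `∀ σ, σ • P₁ ∈ 𝔽_p P₁ ↔ σ • P₂ ∈ 𝔽_p P₂` (hypothesis `hF`; lines are written `AddSubgroup.zmultiples`,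
   which for `p`-torsion elements is the `𝔽_p`-line). No Galois theory enters the kernel statement.
   CONCLUSION: a `G`-equivariant additive (hence `𝔽_p`-linear) isomorphism `V₁ ≃+ V₂` — the cell's
   spelling of "`ρ̄_{E₁,p} ≃ ρ̄_{E₂,p}`" (`TorsionIso`, `GreenbergVatsal2000.thm14_…`, `KrausOesterle1992`).
2. `torsionIso_of_reducible_of_lineStabilizer_iff` — the same for the geometric `p`-torsion
   `E₁[p] = geomTorsion W₁ p`, `E₂[p]` of two elliptic curves over any field `F` with `p ≠ 0` in `F`
   (`#E[p] = p²`: the tree's `card_torsionPoints_eq_sq_holds`, Silverman *AEC* III.6.4(b)), acted on by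
   `Γ_F = Field.absoluteGaloisGroup F`; over a number field `K` this is Theorem 3.6 (⇐) as printed.

PROOF. The printed proof (p. 24) shows `K(E₁[p]) = K(E₂[p])`, identifies both images with one
subgroup `H = D·U` of the Borel, and applies Proposition 3.4 to `φ = ρ̄₁ ∘ ρ̄₂⁻¹` to get a conjugating
matrix `A ∈ B`. We formalise the same conclusion — `ρ̄₁ = A ρ̄₂ A⁻¹` with `A = diag(a, 1)` in the bases
`(T_i, P_i)` — by a shorter road that avoids fixed fields and the automorphism `φ` (a deliberate
deviation, recorded here): writing `σ • P_i = h_i(σ) T_i + χ'(σ) P_i`, the off-diagonal entries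
`h₁, h₂ : G → 𝔽_p` are twisted cocycles `h_i(στ) = χ(σ) h_i(τ) + h_i(σ) χ'(τ)` with the SAME zero set
(`hF`), and (ii) gives `σ₀` with `χ(σ₀) = χ'(σ₀) = 1`, `h₁(σ₀) ≠ 0`; then
`exists_ne_zero_forall_eq_mul` (the substitute for Prop. 3.4): with `a = h₂(σ₀)/h₁(σ₀)` the cocycle
`f = h₂ - a h₁` vanishes on all powers `σ₀ᵏ`, every coset `σ ⟨σ₀⟩` contains an element `σ σ₀ᵏ` with
`h₁ = 0` (solve `χ(σ) k h₁(σ₀) = -h₁(σ)` in `𝔽_p`), hence with `h₂ = 0` and `f = 0`, and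
`f(σ σ₀ᵏ) = f(σ)`; so `h₂ = a h₁`, `a ≠ 0`, and `T₁ ↦ a T₂`, `P₁ ↦ P₂` is the equivariant isomorphism.
The linear algebra (`(T_i, P_i)` is a basis of the plane `V_i`) is Mathlib's
(`LinearIndependent.pair_iff`, `basisOfLinearIndependentOfCardEqFinrank`, `Module.natCard_eq_pow_finrank`).

NOT HERE (deliberately): the "only if" direction of Thm. 3.6 and the index/uniqueness statement of
Prop. 3.5 (not consumed by any certificate); the dictionary fixed field ↔ closed subgroup (infinite
Galois theory) — the statement is kept on the group side, see above; §3.6 of the paper (symplectic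
type in the reducible case).

## References
* J. E. Cremona, N. Freitas, Rev. Mat. Iberoam. 38 (2022), no. 1, 1–32, doi:10.4171/rmi/1269 =
  arXiv:1910.12290v2, §3.5: Prop. 3.4, Prop. 3.5, Thm. 3.6 (pp. 23–24 of the arXiv version).
  [CremonaFreitas2022]
* A. Kraus, J. Oesterlé, Math. Ann. 293 (1992) 259–275, Prop. 4 (the irreducible twin, tree file
  `KrausOesterle1992/TorsionCongruenceCriterion.lean`). [KrausOesterle1992]
* J. H. Silverman, *The Arithmetic of Elliptic Curves*, 2nd ed., Cor. III.6.4(b) (`#E[p] = p²`).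
  [SilvermanAEC2009]
-/

set_option autoImplicit false

noncomputable section

open scoped Classical

namespace Literature.NumberTheory.EllipticCurves.CremonaFreitas2022

/-! ### Step 1 (in place of Proposition 3.4): two twisted cocycles with the same zeros are proportional -/

section Cocycle

variable {G : Type*} [Group G] {p : ℕ} [Fact p.Prime]

/-- **The substitute for Cremona–Freitas Prop. 3.4 used in our proof of Thm. 3.6.** Let
`χ, χ' : G → 𝔽_p` be multiplicative with `χ` non-vanishing, and `h₁, h₂ : G → 𝔽_p` twisted cocycles,
`h_i(στ) = χ(σ) h_i(τ) + h_i(σ) χ'(τ)` (the upper-right entries of two representations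
`σ ↦ (χ h_i; 0 χ')`). If `h₁` and `h₂` have the same zero set and some `σ₀` has
`χ(σ₀) = χ'(σ₀) = 1`, `h₁(σ₀) ≠ 0` (a unipotent element of order `p` in the image), then `h₂ = a·h₁`
for a nonzero constant `a` (so the two representations are conjugate by `diag(a, 1) ∈ B`, which is
what Prop. 3.4 delivers in the printed proof). [cite: CremonaFreitas2022, §3.5, proof of Thm. 3.6 with Prop. 3.4 (arXiv v2 pp. 23–24); this linear-algebra replacement of Prop. 3.4 is ours] -/
theorem exists_ne_zero_forall_eq_mul (χ χ' h₁ h₂ : G → ZMod p)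
    (hχ : ∀ σ τ, χ (σ * τ) = χ σ * χ τ) (hχ' : ∀ σ τ, χ' (σ * τ) = χ' σ * χ' τ)
    (hχ0 : ∀ σ, χ σ ≠ 0)
    (hc₁ : ∀ σ τ, h₁ (σ * τ) = χ σ * h₁ τ + h₁ σ * χ' τ)
    (hc₂ : ∀ σ τ, h₂ (σ * τ) = χ σ * h₂ τ + h₂ σ * χ' τ)
    {σ₀ : G} (hσ₀ : χ σ₀ = 1) (hσ₀' : χ' σ₀ = 1) (hb : h₁ σ₀ ≠ 0)
    (hzero : ∀ σ, h₁ σ = 0 ↔ h₂ σ = 0) :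
    ∃ a : ZMod p, a ≠ 0 ∧ ∀ σ, h₂ σ = a * h₁ σ := by
  have hb₂ : h₂ σ₀ ≠ 0 := fun h => hb ((hzero σ₀).mpr h)
  obtain ⟨a, ha⟩ : ∃ a : ZMod p, a = h₂ σ₀ * (h₁ σ₀)⁻¹ := ⟨_, rfl⟩
  refine ⟨a, by rw [ha]; exact mul_ne_zero hb₂ (inv_ne_zero hb), fun σ => ?_⟩
  -- values at `1`
  have hχ1 : χ 1 = 1 := by
    have h := hχ σ₀ 1
    rw [mul_one, hσ₀, one_mul] at h
    exact h.symm
  have hχ'1 : χ' 1 = 1 := by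
    have h := hχ' σ₀ 1
    rw [mul_one, hσ₀', one_mul] at h
    exact h.symm
  have h₁1 : h₁ 1 = 0 := by
    have e := hc₁ 1 1
    rw [mul_one, hχ1, hχ'1, one_mul, mul_one] at e
    linear_combination -e
  have h₂1 : h₂ 1 = 0 := by
    have e := hc₂ 1 1
    rw [mul_one, hχ1, hχ'1, one_mul, mul_one] at e
    linear_combination -e
  -- values on the powers of `σ₀`
  have hχpow : ∀ k : ℕ, χ (σ₀ ^ k) = 1 := by
    intro k
    induction k with
    | zero => rw [pow_zero, hχ1]
    | succ k ih => rw [pow_succ, hχ, ih, hσ₀, one_mul]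
  have hχ'pow : ∀ k : ℕ, χ' (σ₀ ^ k) = 1 := by
    intro k
    induction k with
    | zero => rw [pow_zero, hχ'1]
    | succ k ih => rw [pow_succ, hχ', ih, hσ₀', one_mul]
  have h₁pow : ∀ k : ℕ, h₁ (σ₀ ^ k) = (k : ZMod p) * h₁ σ₀ := by
    intro k
    induction k with
    | zero => rw [pow_zero, h₁1, Nat.cast_zero, zero_mul]
    | succ k ih =>
      rw [pow_succ, hc₁, hχpow, ih, hσ₀', Nat.cast_succ]
      ring
  -- the cocycle `f = h₂ - a h₁`, which vanishes at `σ₀`, hence on its powers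
  have hf : ∀ σ τ, h₂ (σ * τ) - a * h₁ (σ * τ) =
      χ σ * (h₂ τ - a * h₁ τ) + (h₂ σ - a * h₁ σ) * χ' τ := by
    intro σ τ
    rw [hc₁, hc₂]
    ring
  have hf₀ : h₂ σ₀ - a * h₁ σ₀ = 0 := by
    rw [ha, mul_assoc, inv_mul_cancel₀ hb, mul_one, sub_self]
  have hfpow : ∀ k : ℕ, h₂ (σ₀ ^ k) - a * h₁ (σ₀ ^ k) = 0 := by
    intro k
    induction k with
    | zero => rw [pow_zero, h₁1, h₂1, mul_zero, sub_zero]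
    | succ k ih => rw [pow_succ, hf, ih, hf₀, mul_zero, zero_mul, add_zero]
  -- in the coset `σ ⟨σ₀⟩` there is an element where `h₁`, hence `h₂`, hence `f`, vanishes
  obtain ⟨k, hk⟩ : ∃ k : ℕ, h₁ (σ * σ₀ ^ k) = 0 := by
    refine ⟨(-(h₁ σ) * (χ σ * h₁ σ₀)⁻¹).val, ?_⟩
    rw [hc₁, h₁pow, hχ'pow, ZMod.natCast_zmod_val, mul_one]
    have hne : χ σ * h₁ σ₀ ≠ 0 := mul_ne_zero (hχ0 σ) hb
    calc χ σ * (-(h₁ σ) * (χ σ * h₁ σ₀)⁻¹ * h₁ σ₀) + h₁ σ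
        = -(h₁ σ) * ((χ σ * h₁ σ₀)⁻¹ * (χ σ * h₁ σ₀)) + h₁ σ := by ring
      _ = 0 := by rw [inv_mul_cancel₀ hne]; ring
  have h2k : h₂ (σ * σ₀ ^ k) = 0 := (hzero _).mp hk
  -- and `f (σ σ₀ᵏ) = f σ`
  have hfk : h₂ (σ * σ₀ ^ k) - a * h₁ (σ * σ₀ ^ k) = h₂ σ - a * h₁ σ := by
    rw [hf, hfpow, hχ'pow, mul_zero, zero_add, mul_one]
  rw [hk, h2k, mul_zero, sub_zero] at hfk
  exact (sub_eq_zero.mp hfk.symm)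

end Cocycle

/-! ### Step 2: planes over `𝔽_p` with a marked flag `0 ⊂ 𝔽_p T ⊂ V` (linear algebra) -/

section Plane

variable {p : ℕ} [Fact p.Prime] {V : Type*} [AddCommGroup V] [Module (ZMod p) V]

/-- In an `𝔽_p`-module, `c • T` lies on the line `ℤ T = 𝔽_p T`. [folklore] -/
private theorem zmod_smul_mem_zmultiples (T : V) (c : ZMod p) :
    c • T ∈ AddSubgroup.zmultiples T := by
  rw [← ZMod.natCast_zmod_val c, Nat.cast_smul_eq_nsmul]
  exact (AddSubgroup.zmultiples T).nsmul_mem (AddSubgroup.mem_zmultiples T) _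

/-- In an `𝔽_p`-module, the subgroup `ℤ T` is the `𝔽_p`-line through `T`. [folklore] -/
private theorem exists_zmod_smul_eq_of_mem_zmultiples {T x : V}
    (h : x ∈ AddSubgroup.zmultiples T) : ∃ c : ZMod p, c • T = x := by
  obtain ⟨k, rfl⟩ := AddSubgroup.mem_zmultiples_iff.mp h
  exact ⟨(k : ZMod p), by rw [Int.cast_smul_eq_zsmul]⟩

/-- `T ≠ 0` and `P ∉ 𝔽_p T` make `(T, P)` linearly independent over `𝔽_p`. [folklore] -/
private theorem linearIndependent_pair {T P : V} (hT : T ≠ 0)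
    (hP : P ∉ AddSubgroup.zmultiples T) : LinearIndependent (ZMod p) ![T, P] := by
  rw [LinearIndependent.pair_iff]
  intro s t hst
  by_cases ht : t = 0
  · rw [ht, zero_smul, add_zero] at hst
    exact ⟨(smul_eq_zero.mp hst).resolve_right hT, ht⟩
  · exfalso
    apply hP
    have h : t⁻¹ • (s • T + t • P) = 0 := by rw [hst, smul_zero]
    rw [smul_add, smul_smul, smul_smul, inv_mul_cancel₀ ht, one_smul] at h
    rw [(eq_neg_of_add_eq_zero_right h : P = -((t⁻¹ * s) • T)), ← neg_smul]
    exact zmod_smul_mem_zmultiples T _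

/-- Uniqueness of coordinates with respect to an independent pair. [folklore] -/
private theorem coord_eq {T P : V} (hli : LinearIndependent (ZMod p) ![T, P])
    {s t s' t' : ZMod p} (h : s • T + t • P = s' • T + t' • P) : s = s' ∧ t = t' := by
  have h0 : (s - s') • T + (t - t') • P = 0 := by
    rw [sub_smul, sub_smul, sub_add_sub_comm, h, sub_self]
  obtain ⟨hs, ht⟩ := LinearIndependent.pair_iff.mp hli _ _ h0
  exact ⟨sub_eq_zero.mp hs, sub_eq_zero.mp ht⟩

/-- An `𝔽_p`-module with `p²` elements is a plane. [folklore] -/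
private theorem finrank_eq_two (hcard : Nat.card V = p ^ 2) : Module.finrank (ZMod p) V = 2 := by
  have hp : p.Prime := Fact.out
  haveI : Finite V := Nat.finite_of_card_ne_zero (by rw [hcard]; exact pow_ne_zero 2 hp.ne_zero)
  haveI : Module.Finite (ZMod p) V := Module.Finite.of_finite
  have h := Module.natCard_eq_pow_finrank (K := ZMod p) (V := V)
  rw [hcard, Nat.card_zmod] at h
  exact (Nat.pow_right_injective hp.two_le h).symm

/-- In a plane, an independent pair `(T, P)` is a basis. [folklore] -/
private theorem exists_basis_pair (hcard : Nat.card V = p ^ 2) {T P : V} (hT : T ≠ 0)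
    (hP : P ∉ AddSubgroup.zmultiples T) :
    ∃ b : Module.Basis (Fin 2) (ZMod p) V, b 0 = T ∧ b 1 = P := by
  refine ⟨basisOfLinearIndependentOfCardEqFinrank (linearIndependent_pair hT hP)
    (by rw [Fintype.card_fin, finrank_eq_two hcard]), ?_, ?_⟩ <;> simp

/-- Two additive maps out of a plane that agree on a basis pair `(T, P)` are equal (an additive map
between `𝔽_p`-modules is `𝔽_p`-linear, `AddMonoidHom.toZModLinearMap`). [folklore] -/
private theorem addMonoidHom_eq_of_pair {W : Type*} [AddCommGroup W] [Module (ZMod p) W]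
    (hcard : Nat.card V = p ^ 2) {T P : V} (hT : T ≠ 0) (hP : P ∉ AddSubgroup.zmultiples T)
    {f g : V →+ W} (h0 : f T = g T) (h1 : f P = g P) : f = g := by
  obtain ⟨b, hb0, hb1⟩ := exists_basis_pair hcard hT hP
  apply AddMonoidHom.toZModLinearMap_injective p
  refine b.ext fun i => ?_
  fin_cases i
  · simpa [hb0] using h0
  · simpa [hb1] using h1

/-- A group element acts `𝔽_p`-linearly (it acts additively). [folklore] -/
private theorem smul_zmod_smul {G : Type*} [Group G] [DistribMulAction G V] (σ : G) (c : ZMod p)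
    (x : V) : σ • (c • x) = c • σ • x :=
  ZMod.map_smul (DistribSMul.toAddMonoidHom V σ) c x

end Plane

/-! ### Step 3: Theorem 3.6 (⇐) for abstract `𝔽_p[G]`-modules -/

section Abstract

variable {G : Type*} [Group G] {V₁ : Type*} {V₂ : Type*} [AddCommGroup V₁] [AddCommGroup V₂]
  [DistribMulAction G V₁] [DistribMulAction G V₂] {p : ℕ} [Fact p.Prime]

/-- The matrix entries of a reducible plane: for `T` spanning a `G`-stable line with character `χ`
(given as integers) and `P ∉ 𝔽_p T` with quotient character `χ'`, there are `χ χ' h : G → 𝔽_p` with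
`σ • T = χ(σ) T`, `σ • P = h(σ) T + χ'(σ) P`; `χ, χ'` are multiplicative, `χ` does not vanish, `h` is
the twisted cocycle of Step 1, and `σ` stabilises the line `𝔽_p P` iff `h(σ) = 0` — the field `F` of
Prop. 3.5 is the fixed field of `{σ : h(σ) = 0}`. [cite: CremonaFreitas2022, §3.5, proof of Prop. 3.5 (arXiv v2 p. 23: "Let H be the set of elements σ ∈ G_K such that h(σ) = 0 … Let F ⊂ K(E[p]) be the field fixed by H")] -/
theorem exists_entries_of_stableLine [Module (ZMod p) V₁] {T P : V₁} (hT : T ≠ 0)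
    (hP : P ∉ AddSubgroup.zmultiples T) (χz χ'z : G → ℤ) (hT' : ∀ σ : G, σ • T = χz σ • T)
    (hP' : ∀ σ : G, σ • P - χ'z σ • P ∈ AddSubgroup.zmultiples T) :
    ∃ χ χ' h : G → ZMod p,
      (∀ σ, χ σ = (χz σ : ZMod p)) ∧ (∀ σ, χ' σ = (χ'z σ : ZMod p)) ∧
      (∀ σ, σ • T = χ σ • T) ∧ (∀ σ, σ • P = h σ • T + χ' σ • P) ∧
      (∀ σ τ, χ (σ * τ) = χ σ * χ τ) ∧ (∀ σ τ, χ' (σ * τ) = χ' σ * χ' τ) ∧ (∀ σ, χ σ ≠ 0) ∧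
      (∀ σ τ, h (σ * τ) = χ σ * h τ + h σ * χ' τ) ∧
      (∀ σ, σ • P ∈ AddSubgroup.zmultiples P ↔ h σ = 0) := by
  have hli := linearIndependent_pair (p := p) hT hP
  -- the entries (as opaque functions with their defining equations)
  obtain ⟨χ, hχ⟩ : ∃ χ : G → ZMod p, ∀ σ, χ σ = (χz σ : ZMod p) := ⟨_, fun _ => rfl⟩
  obtain ⟨χ', hχ'⟩ : ∃ χ' : G → ZMod p, ∀ σ, χ' σ = (χ'z σ : ZMod p) := ⟨_, fun _ => rfl⟩
  have hTχ : ∀ σ : G, σ • T = χ σ • T := fun σ => by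
    rw [hχ, Int.cast_smul_eq_zsmul]; exact hT' σ
  have hPh : ∀ σ : G, ∃ c : ZMod p, σ • P = c • T + χ' σ • P := fun σ => by
    obtain ⟨c, hc⟩ := exists_zmod_smul_eq_of_mem_zmultiples (p := p) (hP' σ)
    exact ⟨c, by rw [hc, hχ', Int.cast_smul_eq_zsmul, sub_add_cancel]⟩
  choose h hh using hPh
  refine ⟨χ, χ', h, hχ, hχ', hTχ, hh, ?_, ?_, ?_, ?_, ?_⟩
  · -- `χ` multiplicative: compare `(στ) • T` computed in two ways
    intro σ τ
    apply smul_left_injective (ZMod p) hT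
    change χ (σ * τ) • T = (χ σ * χ τ) • T
    rw [← hTχ, mul_smul σ τ T, hTχ τ, smul_zmod_smul, hTχ σ, smul_smul, mul_comm]
  · -- `χ'` multiplicative: compare the `P`-coordinates of `(στ) • P`
    intro σ τ
    have e : h (σ * τ) • T + χ' (σ * τ) • P =
        (χ σ * h τ + h σ * χ' τ) • T + (χ' σ * χ' τ) • P := by
      rw [← hh, mul_smul σ τ P, hh τ, smul_add, smul_zmod_smul, smul_zmod_smul, hTχ σ, hh σ]
      module
    exact (coord_eq hli e).2
  · -- `χ` does not vanish: `σ` acts injectively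
    intro σ h0
    apply hT
    have e := hTχ σ
    rw [h0, zero_smul] at e
    rw [← inv_smul_smul σ T, e, smul_zero]
  · -- the cocycle identity: compare the `T`-coordinates of `(στ) • P`
    intro σ τ
    have e : h (σ * τ) • T + χ' (σ * τ) • P =
        (χ σ * h τ + h σ * χ' τ) • T + (χ' σ * χ' τ) • P := by
      rw [← hh, mul_smul σ τ P, hh τ, smul_add, smul_zmod_smul, smul_zmod_smul, hTχ σ, hh σ]
      module
    exact (coord_eq hli e).1
  · -- `σ` stabilises the line `𝔽_p P` iff `h σ = 0`
    intro σ
    constructor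
    · intro hmem
      obtain ⟨c, hc⟩ := exists_zmod_smul_eq_of_mem_zmultiples (p := p) hmem
      have e : h σ • T + χ' σ • P = (0 : ZMod p) • T + c • P := by
        rw [← hh, zero_smul, zero_add, hc]
      exact (coord_eq hli e).1
    · intro h0
      rw [hh, h0, zero_smul, zero_add]
      exact zmod_smul_mem_zmultiples P _

/-- Hypothesis (ii) read on the entries: if `ρ(σ₀)` has order `p` (`σ₀^p` acts trivially, `σ₀` does
not), then `χ(σ₀) = χ'(σ₀) = 1` and `h(σ₀) ≠ 0` — "`h ≠ 0` since the image contains an element of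
order `p`. One such element is then `g = (1 1; 0 1)`" (proof of Prop. 3.5). [cite: CremonaFreitas2022, §3.5, proof of Prop. 3.5 (arXiv v2 p. 23)] -/
theorem entries_of_order_eq [Module (ZMod p) V₁] (hcard : Nat.card V₁ = p ^ 2) {T P : V₁}
    (hT : T ≠ 0) (hP : P ∉ AddSubgroup.zmultiples T) {χ χ' h : G → ZMod p}
    (hTχ : ∀ σ : G, σ • T = χ σ • T) (hPh : ∀ σ : G, σ • P = h σ • T + χ' σ • P)
    {σ₀ : G} (hfix : ∀ x : V₁, σ₀ ^ p • x = x) (hmove : ∃ x : V₁, σ₀ • x ≠ x) :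
    χ σ₀ = 1 ∧ χ' σ₀ = 1 ∧ h σ₀ ≠ 0 := by
  have hli := linearIndependent_pair (p := p) hT hP
  -- `σ₀ⁿ • T = χ(σ₀)ⁿ T`
  have hTpow : ∀ n : ℕ, σ₀ ^ n • T = χ σ₀ ^ n • T := by
    intro n
    induction n with
    | zero => rw [pow_zero, pow_zero, one_smul, one_smul]
    | succ n ih =>
      rw [pow_succ, mul_smul (σ₀ ^ n) σ₀ T, hTχ, smul_zmod_smul, ih, smul_smul, pow_succ, mul_comm]
  have hχ : χ σ₀ = 1 := by
    apply smul_left_injective (ZMod p) hT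
    change χ σ₀ • T = (1 : ZMod p) • T
    rw [← ZMod.pow_card (χ σ₀), ← hTpow, hfix, one_smul]
  -- `σ₀ⁿ • P = r T + χ'(σ₀)ⁿ P`
  have hPpow : ∀ n : ℕ, ∃ r : ZMod p, σ₀ ^ n • P = r • T + χ' σ₀ ^ n • P := by
    intro n
    induction n with
    | zero => exact ⟨0, by rw [pow_zero, pow_zero, one_smul, zero_smul, zero_add, one_smul]⟩
    | succ n ih =>
      obtain ⟨r, hr⟩ := ih
      refine ⟨χ σ₀ ^ n * h σ₀ + r * χ' σ₀, ?_⟩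
      rw [pow_succ, mul_smul (σ₀ ^ n) σ₀ P, hPh, smul_add, smul_zmod_smul, smul_zmod_smul, hTpow, hr]
      module
  have hχ' : χ' σ₀ = 1 := by
    obtain ⟨r, hr⟩ := hPpow p
    rw [hfix, ZMod.pow_card] at hr
    have e : (0 : ZMod p) • T + (1 : ZMod p) • P = r • T + χ' σ₀ • P := by
      rw [zero_smul, zero_add, one_smul]; exact hr
    exact ((coord_eq hli e).2).symm
  refine ⟨hχ, hχ', fun h0 => ?_⟩
  -- if `h σ₀ = 0` then `σ₀` fixes `T` and `P`, hence everything
  obtain ⟨x, hx⟩ := hmove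
  apply hx
  have key : DistribSMul.toAddMonoidHom V₁ σ₀ = AddMonoidHom.id V₁ := by
    refine addMonoidHom_eq_of_pair (W := V₁) hcard hT hP ?_ ?_
    · simp [hTχ, hχ]
    · simp [hPh, h0, hχ']
  exact DFunLike.congr_fun key x

/-- **Cremona–Freitas 2022, Theorem 3.6, direction "⇐", for abstract `𝔽_p[G]`-modules.** Let `G` be a
group and `V₁, V₂` two `G`-modules killed by the prime `p` with `p²` elements each (planes over `𝔽_p`).
Assume (i, after the swap normalisation of the printed proof) `T_i ∈ V_i` are nonzero vectors spanning
`G`-stable lines on which `G` acts by the SAME character `χ` and `P_i ∉ 𝔽_p T_i` are vectors on whose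
classes in `V_i / 𝔽_p T_i` it acts by the SAME character `χ'`; (ii) some `σ₀` acts on `V₁` with order
`p` (`σ₀^p` trivially, `σ₀` not); and ("`F₁ ≃ F₂`") the stabilisers of the non-invariant lines
`𝔽_p P₁`, `𝔽_p P₂` coincide. Then `V₁ ≅ V₂` as `G`-modules (a `G`-equivariant additive isomorphism).
See the module docstring for the transcription and the proof. [cite: CremonaFreitas2022, Thm. 3.6 (direction ⇐), §3.5 (arXiv:1910.12290v2 pp. 23–24 = Rev. Mat. Iberoam. 38 (2022) 1–32)] -/
theorem addEquiv_of_reducible_of_lineStabilizer_iff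
    (hV₁ : ∀ x : V₁, p • x = 0) (hV₂ : ∀ x : V₂, p • x = 0)
    (hcard₁ : Nat.card V₁ = p ^ 2) (hcard₂ : Nat.card V₂ = p ^ 2)
    {T₁ : V₁} {T₂ : V₂} (hT₁ : T₁ ≠ 0) (hT₂ : T₂ ≠ 0)
    (hχ : ∀ σ : G, ∃ c : ℤ, σ • T₁ = c • T₁ ∧ σ • T₂ = c • T₂)
    {P₁ : V₁} {P₂ : V₂} (hP₁ : P₁ ∉ AddSubgroup.zmultiples T₁)
    (hP₂ : P₂ ∉ AddSubgroup.zmultiples T₂)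
    (hχ' : ∀ σ : G, ∃ c : ℤ, σ • P₁ - c • P₁ ∈ AddSubgroup.zmultiples T₁ ∧
      σ • P₂ - c • P₂ ∈ AddSubgroup.zmultiples T₂)
    (hord : ∃ σ₀ : G, (∀ x : V₁, σ₀ ^ p • x = x) ∧ ∃ x : V₁, σ₀ • x ≠ x)
    (hF : ∀ σ : G, σ • P₁ ∈ AddSubgroup.zmultiples P₁ ↔ σ • P₂ ∈ AddSubgroup.zmultiples P₂) :
    ∃ e : V₁ ≃+ V₂, ∀ (σ : G) (x : V₁), e (σ • x) = σ • e x := by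
  haveI : Module (ZMod p) V₁ := AddCommGroup.zmodModule hV₁
  haveI : Module (ZMod p) V₂ := AddCommGroup.zmodModule hV₂
  -- the common characters as integer-valued functions
  choose χz hχz using hχ
  choose χ'z hχ'z using hχ'
  -- the entries of the two representations
  obtain ⟨χ, χ', h₁, hχ₁, hχ'₁, hT₁χ, hP₁h, hχmul, hχ'mul, hχ0, hc₁, hstab₁⟩ :=
    exists_entries_of_stableLine (G := G) (p := p) hT₁ hP₁ χz χ'z (fun σ => (hχz σ).1)
      fun σ => (hχ'z σ).1
  obtain ⟨χ₂, χ'₂, h₂, hχ₂, hχ'₂, hT₂χ, hP₂h, -, -, -, hc₂, hstab₂⟩ :=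
    exists_entries_of_stableLine (G := G) (p := p) hT₂ hP₂ χz χ'z (fun σ => (hχz σ).2)
      fun σ => (hχ'z σ).2
  -- the characters of `V₂` ARE those of `V₁` (hypothesis (i))
  have eχ : χ₂ = χ := funext fun σ => by rw [hχ₂, hχ₁]
  have eχ' : χ'₂ = χ' := funext fun σ => by rw [hχ'₂, hχ'₁]
  rw [eχ] at hT₂χ hc₂
  rw [eχ'] at hP₂h hc₂
  -- hypothesis (ii) on the entries
  obtain ⟨σ₀, hfix, hmove⟩ := hord
  obtain ⟨hσ₀, hσ₀', hb⟩ := entries_of_order_eq (G := G) hcard₁ hT₁ hP₁ hT₁χ hP₁h hfix hmove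
  -- same zeros (`F₁ = F₂`), hence proportional entries (Step 1)
  have hzero : ∀ σ, h₁ σ = 0 ↔ h₂ σ = 0 := fun σ => by rw [← hstab₁, ← hstab₂]; exact hF σ
  obtain ⟨a, ha0, ha⟩ :=
    exists_ne_zero_forall_eq_mul χ χ' h₁ h₂ hχmul hχ'mul hχ0 hc₁ hc₂ hσ₀ hσ₀' hb hzero
  -- the isomorphism `T₁ ↦ a T₂`, `P₁ ↦ P₂`
  have haT₂ : a • T₂ ≠ 0 := smul_ne_zero ha0 hT₂
  have haP₂ : P₂ ∉ AddSubgroup.zmultiples (a • T₂) := fun hmem => by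
    obtain ⟨c, hc⟩ := exists_zmod_smul_eq_of_mem_zmultiples (p := p) hmem
    apply hP₂
    rw [← hc, smul_smul]
    exact zmod_smul_mem_zmultiples T₂ _
  obtain ⟨b₁, hb₁0, hb₁1⟩ := exists_basis_pair hcard₁ hT₁ hP₁
  obtain ⟨b₂, hb₂0, hb₂1⟩ := exists_basis_pair hcard₂ haT₂ haP₂
  obtain ⟨e, he0, he1⟩ : ∃ e : V₁ ≃ₗ[ZMod p] V₂, e T₁ = a • T₂ ∧ e P₁ = P₂ := by
    refine ⟨b₁.equiv b₂ (Equiv.refl _), ?_, ?_⟩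
    · rw [← hb₁0, Module.Basis.equiv_apply, Equiv.refl_apply, hb₂0]
    · rw [← hb₁1, Module.Basis.equiv_apply, Equiv.refl_apply, hb₂1]
  refine ⟨e.toAddEquiv, fun σ => ?_⟩
  -- equivariance: the additive maps `e ∘ σ` and `σ ∘ e` agree on `T₁` and `P₁`
  have key : e.toAddEquiv.toAddMonoidHom.comp (DistribSMul.toAddMonoidHom V₁ σ) =
      (DistribSMul.toAddMonoidHom V₂ σ).comp e.toAddEquiv.toAddMonoidHom := by
    refine addMonoidHom_eq_of_pair (W := V₂) hcard₁ hT₁ hP₁ ?_ ?_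
    · change e (σ • T₁) = σ • e T₁
      rw [hT₁χ, map_smul, he0, smul_zmod_smul, hT₂χ, smul_smul, smul_smul, mul_comm]
    · change e (σ • P₁) = σ • e P₁
      rw [hP₁h, map_add, map_smul, map_smul, he0, he1, hP₂h, ha, smul_smul, mul_comm]
  exact fun x => DFunLike.congr_fun key x

end Abstract

/-! ### Step 4: Theorem 3.6 (⇐) for the `p`-torsion of elliptic curves -/

section EllipticCurve

open WeierstrassCurve

variable {F : Type*} [Field F]

/-- `#E[p] = p²` for an elliptic curve over a field in which `p ≠ 0` (Silverman, *AEC*,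
Cor. III.6.4(b); the tree's `card_torsionPoints_eq_sq_holds` over `F̄`). [cite: SilvermanAEC2009, Cor. III.6.4(b)] -/
theorem natCard_geomTorsion_eq_sq (W : WeierstrassCurve F) [W.IsElliptic] {p : ℕ}
    (hpF : (p : F) ≠ 0) : Nat.card (geomTorsion W (p : ℤ)) = p ^ 2 :=
  card_torsionPoints_eq_sq_holds W (AlgebraicClosure F) fun h0 => hpF <| by
    apply (algebraMap F (AlgebraicClosure F)).injective
    rw [map_natCast, map_zero, h0]

/-- Hypothesis (ii) of Thm. 3.6 in the printed form "an element of order `p` in the image of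
`ρ̄_{E,p}`" (`orderOf (galoisRepTorsion W p σ₀) = p`) implies the elementwise form used below:
`σ₀^p` acts trivially on `E[p]` and `σ₀` does not (for `p` prime the two are equivalent,
`orderOf_eq_prime_iff`). [cite: CremonaFreitas2022, Thm. 3.6 hypothesis (ii) (arXiv v2 p. 23)] -/
theorem smul_pow_eq_and_exists_ne_of_orderOf_eq (W : WeierstrassCurve F) (p : ℕ) [Fact p.Prime]
    {σ₀ : Field.absoluteGaloisGroup F} (h : orderOf (galoisRepTorsion W (p : ℤ) σ₀) = p) :
    (∀ x : geomTorsion W (p : ℤ), σ₀ ^ p • x = x) ∧ ∃ x : geomTorsion W (p : ℤ), σ₀ • x ≠ x := by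
  rw [orderOf_eq_prime_iff] at h
  obtain ⟨hpow, hne⟩ := h
  refine ⟨fun x => ?_, ?_⟩
  · have hx := congrArg (fun f => (Multiplicative.toAdd f) x) hpow
    rw [← map_pow] at hx
    exact hx
  · by_contra hall
    apply hne
    apply Multiplicative.toAdd.injective
    refine AddEquiv.ext fun x => ?_
    exact (not_not.mp (not_exists.mp hall x) : σ₀ • x = x)

/-- **Cremona–Freitas 2022, Theorem 3.6 (⇐): the reducible criterion for `E₁[p] ≅ E₂[p]`.** Let
`E₁ = W₁`, `E₂ = W₂` be elliptic curves over a field `F` with `p ≠ 0` in `F` (over a number field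
`K`: the printed setting), `Γ_F = Gal(F̄/F)` acting on the geometric `p`-torsion `E_i[p]`. Suppose:
(i) `T_i ∈ E_i[p]` are nonzero points spanning `Γ_F`-stable lines (the kernels of the `p`-isogenies)
with the SAME isogeny character (`σ T₁ = c T₁`, `σ T₂ = c T₂`), and `Γ_F` acts on `E_i[p] / 𝔽_p T_i`
by the SAME character (read on points `P_i ∉ 𝔽_p T_i`) — this is "`ρ̄^{ss}_{E₁,p} ≃ ρ̄^{ss}_{E₂,p} ≃
χ ⊕ χ'` after replacing `E₂` by a `p`-isogenous curve if necessary"; (ii) some `σ₀ ∈ Γ_F` acts on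
`E₁[p]` with order `p` (printed for both curves; for `E₂` it follows); and the degree-`p` fields over
which `E₁`, `E₂` acquire a second isogeny agree: the stabilisers in `Γ_F` of the non-invariant lines
`𝔽_p P₁`, `𝔽_p P₂` coincide ("`F₁ ≃ F₂` as extensions of `K`", for a suitable choice of the lines in
their conjugacy classes, Prop. 3.5). Then there is a `Γ_F`-equivariant isomorphism `E₁[p] ≃ E₂[p]`
— the conclusion in the spelling of `TorsionIso` / `GreenbergVatsal2000.thm14_…` /
`KrausOesterle1992.prop4_torsionIso_of_congruences` (whose reducible twin this is). PROVED (module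
docstring). [cite: CremonaFreitas2022, Thm. 3.6 (direction ⇐) with Prop. 3.5, §3.5 (arXiv:1910.12290v2 pp. 23–24 = Rev. Mat. Iberoam. 38 (2022) 1–32)] -/
theorem torsionIso_of_reducible_of_lineStabilizer_iff (W₁ W₂ : WeierstrassCurve F) [W₁.IsElliptic]
    [W₂.IsElliptic] (p : ℕ) [Fact p.Prime] (hpF : (p : F) ≠ 0)
    {T₁ : geomTorsion W₁ (p : ℤ)} {T₂ : geomTorsion W₂ (p : ℤ)} (hT₁ : T₁ ≠ 0) (hT₂ : T₂ ≠ 0)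
    (hχ : ∀ σ : Field.absoluteGaloisGroup F, ∃ c : ℤ, σ • T₁ = c • T₁ ∧ σ • T₂ = c • T₂)
    {P₁ : geomTorsion W₁ (p : ℤ)} {P₂ : geomTorsion W₂ (p : ℤ)}
    (hP₁ : P₁ ∉ AddSubgroup.zmultiples T₁) (hP₂ : P₂ ∉ AddSubgroup.zmultiples T₂)
    (hχ' : ∀ σ : Field.absoluteGaloisGroup F, ∃ c : ℤ,
      σ • P₁ - c • P₁ ∈ AddSubgroup.zmultiples T₁ ∧ σ • P₂ - c • P₂ ∈ AddSubgroup.zmultiples T₂)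
    (hord : ∃ σ₀ : Field.absoluteGaloisGroup F,
      (∀ x : geomTorsion W₁ (p : ℤ), σ₀ ^ p • x = x) ∧ ∃ x : geomTorsion W₁ (p : ℤ), σ₀ • x ≠ x)
    (hF : ∀ σ : Field.absoluteGaloisGroup F,
      σ • P₁ ∈ AddSubgroup.zmultiples P₁ ↔ σ • P₂ ∈ AddSubgroup.zmultiples P₂) :
    ∃ e : geomTorsion W₁ (p : ℤ) ≃+ geomTorsion W₂ (p : ℤ),
      ∀ (σ : Field.absoluteGaloisGroup F) (P : geomTorsion W₁ (p : ℤ)), e (σ • P) = σ • e P :=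
  addEquiv_of_reducible_of_lineStabilizer_iff (G := Field.absoluteGaloisGroup F)
    (fun x => AddSubgroup.torsionBy.nsmul x) (fun x => AddSubgroup.torsionBy.nsmul x)
    (natCard_geomTorsion_eq_sq W₁ hpF) (natCard_geomTorsion_eq_sq W₂ hpF) hT₁ hT₂ hχ hP₁ hP₂ hχ'
    hord hF

/-- **Theorem 3.6 (⇐) with hypothesis (ii) in the printed form** "`ρ̄_{E₁,p}` has an element of
order `p` in its image" (`orderOf (galoisRepTorsion W₁ p σ₀) = p`); otherwise as
`torsionIso_of_reducible_of_lineStabilizer_iff`. [cite: CremonaFreitas2022, Thm. 3.6 (direction ⇐), §3.5 (arXiv:1910.12290v2 pp. 23–24)] -/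
theorem torsionIso_of_reducible_of_orderOf_eq (W₁ W₂ : WeierstrassCurve F) [W₁.IsElliptic]
    [W₂.IsElliptic] (p : ℕ) [Fact p.Prime] (hpF : (p : F) ≠ 0)
    {T₁ : geomTorsion W₁ (p : ℤ)} {T₂ : geomTorsion W₂ (p : ℤ)} (hT₁ : T₁ ≠ 0) (hT₂ : T₂ ≠ 0)
    (hχ : ∀ σ : Field.absoluteGaloisGroup F, ∃ c : ℤ, σ • T₁ = c • T₁ ∧ σ • T₂ = c • T₂)
    {P₁ : geomTorsion W₁ (p : ℤ)} {P₂ : geomTorsion W₂ (p : ℤ)}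
    (hP₁ : P₁ ∉ AddSubgroup.zmultiples T₁) (hP₂ : P₂ ∉ AddSubgroup.zmultiples T₂)
    (hχ' : ∀ σ : Field.absoluteGaloisGroup F, ∃ c : ℤ,
      σ • P₁ - c • P₁ ∈ AddSubgroup.zmultiples T₁ ∧ σ • P₂ - c • P₂ ∈ AddSubgroup.zmultiples T₂)
    {σ₀ : Field.absoluteGaloisGroup F} (hord : orderOf (galoisRepTorsion W₁ (p : ℤ) σ₀) = p)
    (hF : ∀ σ : Field.absoluteGaloisGroup F,
      σ • P₁ ∈ AddSubgroup.zmultiples P₁ ↔ σ • P₂ ∈ AddSubgroup.zmultiples P₂) :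
    ∃ e : geomTorsion W₁ (p : ℤ) ≃+ geomTorsion W₂ (p : ℤ),
      ∀ (σ : Field.absoluteGaloisGroup F) (P : geomTorsion W₁ (p : ℤ)), e (σ • P) = σ • e P :=
  torsionIso_of_reducible_of_lineStabilizer_iff W₁ W₂ p hpF hT₁ hT₂ hχ hP₁ hP₂ hχ'
    ⟨σ₀, smul_pow_eq_and_exists_ne_of_orderOf_eq W₁ p hord⟩ hF

end EllipticCurve

end Literature.NumberTheory.EllipticCurves.CremonaFreitas2022

end
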